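import Summits.Ventures.PackingBounds.Energy.GramDataCheck
import HarnessLib

/-!
# Strict positive definiteness with an explicit margin from the same integer data (`Y = L Lᵀ + E`)

Framing: lottery ticket; floor = certified bounds/negative ranges. Venture `PackingBounds`, cell
`pub-packcert`, energy family E3PT (pub-packcert-energy gen 12) — KERNEL-D6 infrastructure.

The kernel-checked data `S·Y = L Lᵀ + E` of a Gram block always has slack in the diagonal dominance of `E`
(the Cholesky factor is computed for `Y − shift·I`). This file turns a checked MARGIN
`Σ_{j<r} |E_{ij}| + 2m ≤ 2 E_{ii}` (Boolean checker `GramData.checkDDm`, discharged by `decide +kernel`) into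
the strict bound `m · Σ_i y_i² ≤ Σ_{i,j<r} Y_{ij} y_i y_j` (`GramData.pd_of_checks_margin`), via
`GramPSD.quadForm_diagDominant_margin` / `quadForm_split_margin` (reduction to the landed non-strict
criterion applied to `E − m·I`). Intended use: complementary slackness for certificates whose potential is
the polynomial itself (no Hermite minorant step): `slack(u,v,t) = 0 ⇒ w(u,v,t) = 0`.
-/

noncomputable section

open Finset

namespace Summit.Ventures.PackingBounds.Energy.GramPSD

variable {ι κ : Type*} [Fintype ι] [Fintype κ]

/-- **Diagonal dominance with margin ⇒ strictly positive quadratic form.** If `E` is symmetric and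
`Σ_j |E_{ij}| + 2m ≤ 2 E_{ii}` for every `i` (`m ≥ 0`), then `m · Σ_i y_i² ≤ Σ_{i,j} E_{ij} y_i y_j`. -/
theorem quadForm_diagDominant_margin [DecidableEq ι] (E : ι → ι → ℝ) (m : ℝ) (hm : 0 ≤ m)
    (hs : ∀ i j, E i j = E j i) (hdd : ∀ i, ∑ j, |E i j| + 2 * m ≤ 2 * E i i) (y : ι → ℝ) :
    m * ∑ i, y i ^ 2 ≤ ∑ i, ∑ j, E i j * y i * y j := by
  -- E' := E - m·I is symmetric and diagonally dominant
  set E' : ι → ι → ℝ := fun i j => E i j - if i = j then m else 0 with hE'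
  have hdiag : ∀ i, m ≤ E i i := by
    intro i
    have h := hdd i
    have h0 : 0 ≤ ∑ j, |E i j| := Finset.sum_nonneg fun j _ => abs_nonneg _
    have h1 : |E i i| ≤ ∑ j, |E i j| :=
      Finset.single_le_sum (f := fun j => |E i j|) (fun j _ => abs_nonneg _) (Finset.mem_univ i)
    have h2 : E i i ≤ |E i i| := le_abs_self _
    linarith
  have hs' : ∀ i j, E' i j = E' j i := by
    intro i j
    simp only [hE']
    by_cases h : i = j
    · subst h; rfl
    · rw [if_neg h, if_neg (Ne.symm h), hs i j]
  have habs : ∀ i, ∑ j, |E' i j| = (∑ j, |E i j|) - m := by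
    intro i
    have h1 : ∑ j, |E' i j| = ∑ j, (|E i j| - if i = j then m else 0) := by
      refine Finset.sum_congr rfl fun j _ => ?_
      simp only [hE']
      by_cases h : i = j
      · subst h
        rw [if_pos rfl, abs_of_nonneg (by linarith [hdiag i] : (0:ℝ) ≤ E i i - m),
          abs_of_nonneg (by linarith [hdiag i] : (0:ℝ) ≤ E i i)]
      · rw [if_neg h, sub_zero, sub_zero]
    rw [h1, Finset.sum_sub_distrib, Finset.sum_ite_eq univ i (fun _ => m), if_pos (Finset.mem_univ i)]
  have hdd' : ∀ i, ∑ j, |E' i j| ≤ 2 * E' i i := by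
    intro i
    rw [habs i]
    have : E' i i = E i i - m := by simp only [hE', if_true]
    rw [this]
    linarith [hdd i]
  have hpsd := quadForm_diagDominant_nonneg E' hs' hdd' y
  -- Σ E' y y = Σ E y y - m Σ y²
  have hsplit : ∑ i, ∑ j, E' i j * y i * y j = (∑ i, ∑ j, E i j * y i * y j) - m * ∑ i, y i ^ 2 := by
    have h1 : ∀ i, ∑ j, E' i j * y i * y j = (∑ j, E i j * y i * y j) - m * y i ^ 2 := by
      intro i
      have : ∑ j, E' i j * y i * y j = ∑ j, (E i j * y i * y j - (if i = j then m else 0) * y i * y j) := by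
        refine Finset.sum_congr rfl fun j _ => ?_
        simp only [hE']; ring
      rw [this, Finset.sum_sub_distrib]
      congr 1
      rw [show (fun j => (if i = j then m else 0) * y i * y j) = fun j => if i = j then m * y i ^ 2 else 0 from
        funext fun j => by by_cases h : i = j <;> simp [h, sq, mul_assoc]]
      rw [Finset.sum_ite_eq univ i (fun _ => m * y i ^ 2), if_pos (Finset.mem_univ i)]
    rw [Finset.sum_congr rfl fun i _ => h1 i, Finset.sum_sub_distrib, ← Finset.mul_sum]
  rw [hsplit] at hpsd
  linarith

/-- **Split criterion with margin.** `Y = L Lᵀ + E`, `E` symmetric with `Σ_j |E_{ij}| + 2m ≤ 2E_{ii}` ⇒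
`m · Σ_i y_i² ≤ Σ_{i,j} Y_{ij} y_i y_j`. -/
theorem quadForm_split_margin [DecidableEq ι] (Y E : ι → ι → ℝ) (L : ι → κ → ℝ) (m : ℝ) (hm : 0 ≤ m)
    (hY : ∀ i j, Y i j = ∑ c, L i c * L j c + E i j) (hs : ∀ i j, E i j = E j i)
    (hdd : ∀ i, ∑ j, |E i j| + 2 * m ≤ 2 * E i i) (y : ι → ℝ) :
    m * ∑ i, y i ^ 2 ≤ ∑ i, ∑ j, Y i j * y i * y j := by
  have h1 := quadForm_gram_nonneg L y
  have h2 := quadForm_diagDominant_margin E m hm hs hdd y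
  have : ∑ i, ∑ j, Y i j * y i * y j
      = (∑ i, ∑ j, (∑ c, L i c * L j c) * y i * y j) + ∑ i, ∑ j, E i j * y i * y j := by
    rw [← Finset.sum_add_distrib]
    refine Finset.sum_congr rfl fun i _ => ?_
    rw [← Finset.sum_add_distrib]
    refine Finset.sum_congr rfl fun j _ => ?_
    rw [hY]; ring
  rw [this]
  linarith

end Summit.Ventures.PackingBounds.Energy.GramPSD

namespace Summit.Ventures.PackingBounds.Energy.GramData

open Finset

/-- Diagonal dominance WITH MARGIN `m`: `Σ_{j<r} |E_{ij}| + 2m ≤ 2 E_{ii}` for all `i < r`. -/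
def checkDDm (r : ℕ) (m : ℕ) (E : List (List ℤ)) : Bool :=
  (List.range r).all fun i => decide (absRow E i r + 2 * (m : ℤ) ≤ 2 * ent E i i)

/-- Unpack a checked diagonal-dominance-with-margin fact. -/
theorem of_checkDDm {r m : ℕ} {E : List (List ℤ)} (h : checkDDm r m E = true) :
    ∀ i, i < r → absRow E i r + 2 * (m : ℤ) ≤ 2 * ent E i i := by
  intro i hi
  simp only [checkDDm, List.all_eq_true, List.mem_range, decide_eq_true_eq] at h
  exact h i hi

/-- **Strict PSD with margin from checked integer data.** If `Y_{ij} = Σ_{c<s} L_{ic}L_{jc} + E_{ij}`,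
`E_{ij} = E_{ji}` for all `i, j < r` and `Σ_{j<r}|E_{ij}| + 2m ≤ 2E_{ii}` for all `i < r`, then
`m · Σ_{i<r} y_i² ≤ Σ_{i,j<r} Y_{ij} y_i y_j` for every real `y`. -/
theorem pd_of_checks_margin (r s m : ℕ) (Y L E : List (List ℤ))
    (hrows : ∀ i j, i < r → j < r → ent Y i j = dotRows L i j s + ent E i j ∧ ent E i j = ent E j i)
    (hdd : ∀ i, i < r → absRow E i r + 2 * (m : ℤ) ≤ 2 * ent E i i) (y : Fin r → ℝ) :
    (m : ℝ) * ∑ i : Fin r, y i ^ 2 ≤ ∑ i : Fin r, ∑ j : Fin r, (ent Y i j : ℝ) * y i * y j := by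
  refine GramPSD.quadForm_split_margin (ι := Fin r) (κ := Fin s)
    (fun i j => (ent Y i j : ℝ)) (fun i j => (ent E i j : ℝ)) (fun i c => (ent L i c : ℝ)) (m : ℝ)
    (Nat.cast_nonneg m) ?_ ?_ ?_ y
  · intro i j
    have h := (hrows i j i.2 j.2).1
    have hc : (ent Y i j : ℝ) = (dotRows L i j s : ℝ) + (ent E i j : ℝ) := by exact_mod_cast h
    rw [hc, dotRows_eq, Fin.sum_univ_eq_sum_range (fun c => (ent L i c : ℝ) * (ent L j c : ℝ)) s]
  · intro i j
    exact_mod_cast (hrows i j i.2 j.2).2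
  · intro i
    have h := hdd i i.2
    have hc : (absRow E i r : ℝ) + 2 * (m : ℝ) ≤ 2 * (ent E i i : ℝ) := by exact_mod_cast h
    rw [absRow_eq, ← Fin.sum_univ_eq_sum_range (fun c => |((ent E i c : ℝ))|) r] at hc
    exact hc

end Summit.Ventures.PackingBounds.Energy.GramData
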